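import Mathlib
import HarnessLib

/-!
# Sums and differences along graphs: the Katz–Tao bounds `N^{2 − 1/6}` and `N^{2 − 1/4}` (Katz–Tao 1999, Theorem 1.1)

Topic `Literature/Combinatorics/Kakeya` — the first rung of the "arithmetic" (sums–differences)
approach to the Kakeya conjecture (Bourgain 1999; Katz–Tao 1999, 2002), whose exponents
`SD ≤ α` give "Besicovitch sets in `ℝⁿ` have Minkowski dimension at least `(n−1)/α + 1`".
Everything in this file is PROVED (no named fact, no `sorry`); the content is purely
additive-combinatorial (finite subsets of an abelian group; cf. `Literature/Combinatorics/Additive`).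

Source: N. H. Katz, T. Tao, *Bounds on arithmetic projections, and applications to the Kakeya
conjecture*, Math. Res. Lett. **6** (1999), 625–630, doi:10.4310/mrl.1999.v6.n6.a3
(arXiv:math/9906097).  §1, verbatim (p. 625): "Let `N` be a positive integer, and let `(Z, +)`
be an abelian group. Let `A, B`, be finite subsets of `Z` with cardinality
(1) `#A, #B ≤ N`.  Let `G` be a subset of `A × B`. We consider the question of bounding the
quantity (2) `#{a − b : (a, b) ∈ G}`. Without any further assumptions on `G` one can only obtain
the trivial bound of `N²`. However, in [2] Bourgain showed that under the additional assumption
(3) `#C ≤ N`, where `C = {a + b : (a, b) ∈ G}`, that one could improve the bound on (2) to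
`N^{2 − 1/13}`. The purpose of this paper is to obtain the following additional improvements.

> **Theorem 1.1.** Let the notation and assumptions be as above. Then we have
> (4) `(2) ≤ N^{2 − 1/6}`.
> If we make the further additional assumption
> (5) `#D ≤ N`, where `D = {a + 2b : (a, b) ∈ G}`,
> then we may improve this further to
> (6) `(2) ≤ N^{2 − 1/4}`."

and §2, verbatim (p. 627):

> **Lemma 2.1.** Let `X` and `A₁, …, Aₙ` be finite sets for some `n ≥ 0`, and for each
> `1 ≤ i ≤ n` let `fᵢ : X → Aᵢ` be a function. Then
> (7) `#{(x₀, …, xₙ) ∈ X^{n+1} : fᵢ(x_{i−1}) = fᵢ(xᵢ) for all 1 ≤ i ≤ n} ≥ (#X)^{n+1} / ∏ᵢ₌₁ⁿ #Aᵢ`.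

(The abstract says "finite subsets of a torsion-free abelian group"; §1 says "an abelian group",
and the printed proof of Theorem 1.1 — followed line by line below — uses no torsion hypothesis,
so the theorems here are stated for every abelian group `Z` (`AddCommGroup`).  The application,
Corollary 1.2 — Minkowski dimension `≥ 4n/7 + 3/7`, Hausdorff dimension `≥ 6n/11 + 5/11` for
Besicovitch sets in `ℝⁿ`, "by the arguments in [2]" (Bourgain) — is NOT in this file.)

## Setting and definitions

`Z` is an abelian group, `A B : Finset Z`, `G : Finset (Z × Z)` with `G ⊆ A ×ˢ B`, `N : ℕ`;
`sums G = {a + b}`, `diffs G = {a − b}`, `sumsTwo G = {a + 2 • b}` (images of `G`), so that (2) is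
`(diffs G).card`, (3) is `(sums G).card ≤ N` and (5) is `(sumsTwo G).card ≤ N`.  For Lemma 2.1:
`chains X f` (`X : Finset α`, `f : Fin n → α → Y`) is the finset of `x : Fin (n+1) → α` with all
`x j ∈ X` and `f i (x i.castSucc) = f i (x i.succ)` for all `i : Fin n`; the targets `Aᵢ` are
finsets `A i : Finset Y` of ONE ambient type `Y` with `f i '' X ⊆ A i` (the printed `fᵢ : X → Aᵢ`
with unrelated finite sets `Aᵢ` is the case `Y = A₁ ⊔ ⋯ ⊔ Aₙ`; conversely any such family is a
family of maps `X → Aᵢ`).  The sets of the proof: `vert G` = `V` of display (12) (triples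
`(a, b, b′)` with `(a, b), (a, b′) ∈ G`), `ess G` = `S` (chains of `V` for
`f₁(a,b,b′) = (a + b, a + b′)`, `f₂ = (b, b′)`, `f₃ = (a + b, b′)` — `mapF₁`, `mapF₂`, `mapF₃`),
`tee G` = `T` of §4 (chains of `V` for `f₁(a,b,b′) = (a + 2b, b′)` — `mapF₄`).

## What is proved

* **`card_diffs_le_rpow` — Theorem 1.1 (4) exactly as printed: `#{a − b : (a,b) ∈ G} ≤ N^{2−1/6}`**
  (over `ℝ`), from the integer form **`card_diffs_pow_six_le`: `#{a − b}⁶ ≤ N¹¹`**;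
* **`card_diffs_le_rpow_of_sumsTwo` — Theorem 1.1 (6) exactly as printed: under (5) as well,
  `#{a − b : (a,b) ∈ G} ≤ N^{2−1/4}`**, from **`card_diffs_pow_four_le`: `#{a − b}⁴ ≤ N⁷`**;
* **`card_pow_le_card_chains_mul_prod` — Lemma 2.1 exactly as printed**, cleared of denominators:
  `(#X)^{n+1} ≤ #chains · ∏ᵢ #Aᵢ` (`card_pow_div_prod_le_card_chains` is display (7) over `ℝ`);
* the printed steps: `exists_subset_injOn_card_eq` ((10): "we may assume `(a, b) ↦ a − b` is
  one-to-one on `G`"), `card_sq_le_card_vert_mul` ((13) `#V ≥ (#G)²/N`), `card_vert_pow_four_le`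
  ((14) `#S ≥ (#V)⁴/N⁶`), `ess_key` (`a₃ − b₃′ = a₂ − b₃ + b₀ − b₀′`), `card_ess_le` ("`g` is
  injective": `#S ≤ N² #V`), `card_pow_six_le_of_injOn` ((11) `#G ≤ N^{11/6}`);
  `card_vert_sq_le` ((18) `#T ≥ (#V)²/N²`), `tee_key` (`a₁ − b₁′ = 2(a₀ + b₀) − 2b₁ − (a₀ + b₀′)`),
  `card_tee_le` ("`h` is injective": `#T ≤ N³`), `card_pow_four_le_of_injOn` ((17) `#G ≤ N^{7/4}`);
* the examples of §1 (p. 626): **`exists_card_diffs_eq_six_pow`** — `Z = ℤⁿ`, `A = B = {0,1,3}ⁿ`,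
  `C ⊆ {1,3,4}ⁿ`, `G = {(0,1),(0,3),(1,0),(1,3),(3,0),(3,1)}ⁿ`: `N = 3ⁿ` and (2) `= #G = 6ⁿ`
  (`= N^{log 6/log 3}`, `six_pow_eq_rpow`); **`exists_card_diffs_eq_eight_pow`** — with (5) too,
  `A = {0,2,3,4}ⁿ`, `B = {0,1,2,3}ⁿ`, `C ⊆ {2,3,4,5}ⁿ`, `D ⊆ {4,5,6,8}ⁿ`, `#G = (2) = 8ⁿ = N^{3/2}`,
  `N = 4ⁿ` (tool: `powGraph`, the `n`-fold power of a set of pairs, `card_diffs_powGraph`).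

## Proof architecture (as printed), and remarks on the printed text

*Lemma 2.1.*  The popularity induction of the printed proof, with its loss of a constant
(`card_pow_le_two_pow_mul_card_chains`: "define `a ∈ Aₙ` to be popular if
`#{x : fₙ(x) = a} ≥ #X/(2#Aₙ)` … `#X′ ≥ #X/2` (8) … by applying the induction hypothesis to `X′`
…" — we carry the constant `2^{(n+1)²}`; the printed constant is `2^{−n−1}`, and any constant
depending only on `n` serves), then the tensor-power trick ("we let `M` be a large integer, and
apply (9) with `X, Aᵢ` replaced by `X^M, Aᵢ^M`, and `fᵢ` replaced with `fᵢ^M` … The claim then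
follows by letting `M → ∞`"): `card_chains_pow` (the chains of the `M`-th power are the
`M`-tuples of chains, by transposition) and `le_of_pow_le_mul_pow` (`a^M ≤ K c^M` for all `M`
forces `a ≤ c`).

*Theorem 1.1 (4)* (§3).  Reduce to `G` with `(a,b) ↦ a − b` injective (a section of
`G → diffs G`); `V` and (13) by Lemma 2.1 with `n = 1` (the chains `(x₀, x₁) ∈ G²`, `x₀.1 = x₁.1`
are in bijection with `V`); `S` and (14) by Lemma 2.1 with `n = 3` and the targets `C × C`,
`B × B`, `C × B`; `g(v₀,v₁,v₂,v₃) = (v₀, a₂, b₃)` is injective on `S` because — (15)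
`a₀ + b₀ = a₁ + b₁`, `a₀ + b₀′ = a₁ + b₁′`, `b₁ = b₂`, `b₁′ = b₂′`; (16) `a₂ + b₂ = a₃ + b₃`,
`b₂′ = b₃′` — "`b₀ − b₀′ = b₁ − b₁′ = b₂ − b₂′`" and "`a₃ − b₃′ = a₃ + b₃ − b₃ − b₂′ =
a₂ + b₂ − b₂′ − b₃`", so "`a₃ − b₃′ = a₂ − b₃ + b₀ − b₀′`" is determined by `(v₀, a₂, b₃)`, and
subtraction is injective on `G` (the primes, dropped by some text renderings of the journal PDF,
are those of the arXiv version math/9906097).  Then `(#V)⁴ ≤ N⁸ #V`, `(#G)² ≤ N #V` give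
`(#G)⁶ ≤ N¹¹`.

*Theorem 1.1 (6)* (§4).  `T`, (18) by Lemma 2.1 with `n = 1` and target `D × B`;
`h(v₀, v₁) = (a₀ + b₀, a₀ + b₀′, b₁)` is injective on `T` because (19) `a₀ + 2b₀ = a₁ + 2b₁`,
`b₀′ = b₁′` give `a₁ − b₁′ = 2(a₀ + b₀) − 2b₁ − (a₀ + b₀′)`; so `#T ≤ N³`, `(#V)² ≤ N⁵`,
`(#G)⁴ ≤ N⁷`.

No deviation from the printed argument.  Generalisations, declared: `Z` any abelian group (see
above); `G ⊆ A × B` any finite set of pairs (as printed); in Lemma 2.1 the maps need only send `X`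
into the `Aᵢ` (values outside `X` are irrelevant).

Section `LargeN` restates the examples in the printed form "(2) can be as large as
`N^{log 6/log 3}`" / "`N^{log 8/log 4}`" for arbitrarily large `N` (`exists_card_diffs_eq_rpow_log`,
`exists_card_diffs_eq_rpow_three_halves`) and draws the consequence that the exponent of (4) cannot
be lowered below `log 6/log 3` (`exists_rpow_lt_card_diffs`; Mattila: "one cannot take `ε₀` larger
than `2 − log 6/log 3`").

Secondary source: P. Mattila, *Fourier Analysis and Hausdorff Dimension* (Cambridge, 2015), §23.3
"Bourgain's arithmetic method", reproduces Theorem 1.1 (4) as **Proposition 23.8** (for subsets of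
`λℤᵐ`, "it holds for any free Abelian group") with this proof — **Lemma 23.9** = Lemma 2.1 with the
popularity/tensor-power proof, the maps `f₁, f₂, f₃`, (23.41) `#S ≥ (#V)⁴/N⁶`, `g = (v₀, a₂, b₃)` —
and the `{0, 1, 3}` example; its Theorem 23.7 is the application `dim_M B ≥ 6n/11 + 5/11`.

## Not in this file

Corollary 1.2 (the Kakeya dimension bounds, via Bourgain's "three slices" reduction; Mattila's
Theorem 23.7); Bourgain's `N^{2−1/13}`; the later exponents (Katz–Tao 2002, `SD ≤ 1.67513…`);
the arithmetic Kakeya conjecture (`SD = 1`).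

## References
* [KatzTao1999ArithmeticProjections] N. H. Katz, T. Tao, Math. Res. Lett. 6 (1999), 625–630,
  doi:10.4310/mrl.1999.v6.n6.a3 — Theorem 1.1 (p. 625), the examples (p. 626),
  Lemma 2.1 (pp. 627–628), §3 (pp. 628–629), §4 (pp. 629–630); arXiv version math/9906097
  ("A new bound on partial sum-sets and difference-sets, and applications to the Kakeya
  conjecture"), same numbering of Theorem 1.1 and Lemma 2.1, read alongside for the sub- and
  superscripts.
* J. Bourgain, *On the dimension of Kakeya sets and related maximal inequalities*, Geom. Funct.
  Anal. 9 (1999), 256–282 — the `N^{2−1/13}` bound and the reduction to Kakeya, cited through the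
  source as [2].
* [Mattila2015] P. Mattila, *Fourier Analysis and Hausdorff Dimension*, Cambridge Stud. Adv.
  Math. 150 (2015), doi:10.1017/CBO9781316227619 — §23.3, Proposition 23.8, Lemma 23.9 and the
  example on p. 345 (secondary source, read pp. 343–347).
-/

namespace Literature.Combinatorics.Kakeya

namespace SumsDifferences

open Finset

section CombinatorialLemma

/-! ### Lemma 2.1 — the combinatorial lemma -/

variable {α Y : Type*} [DecidableEq Y] {n : ℕ}

/-- **The chains of Lemma 2.1**: for a finite set `X` and maps `f₁, …, fₙ` on `X`, the set of
`(x₀, …, xₙ) ∈ X^{n+1}` with `fᵢ(x_{i−1}) = fᵢ(xᵢ)` for all `1 ≤ i ≤ n` (indices shifted to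
`i : Fin n`, the condition reading `f i (x i.castSucc) = f i (x i.succ)`).
[cite: KatzTao1999ArithmeticProjections, Lemma 2.1 (p. 627, display (7))] -/
def chains (X : Finset α) (f : Fin n → α → Y) : Finset (Fin (n + 1) → α) :=
  (Fintype.piFinset fun _ : Fin (n + 1) => X).filter
    fun x => ∀ i : Fin n, f i (x (Fin.castSucc i)) = f i (x (Fin.succ i))

/-- Membership in `chains X f`. [cite: KatzTao1999ArithmeticProjections, Lemma 2.1 (p. 627)] -/
theorem mem_chains_iff {X : Finset α} {f : Fin n → α → Y} {x : Fin (n + 1) → α} :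
    x ∈ chains X f ↔
      (∀ j, x j ∈ X) ∧ ∀ i : Fin n, f i (x (Fin.castSucc i)) = f i (x (Fin.succ i)) := by
  simp only [chains, Finset.mem_filter, Fintype.mem_piFinset]

/-- With no map (`n = 0`) the chains are the points of `X`: `|chains| = |X|`. [folklore] -/
private theorem card_chains_zero (X : Finset α) (f : Fin 0 → α → Y) :
    (chains X f).card = X.card := by
  have h : chains X f = Fintype.piFinset fun _ : Fin 1 => X := by
    ext x
    simp only [mem_chains_iff, Fintype.mem_piFinset, IsEmpty.forall_iff, and_true]
  rw [h, Fintype.card_piFinset_const, pow_one]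

/-- **The popularity induction of the printed proof, with its loss of constants**: for maps
`fᵢ : X → Aᵢ`, `|X|^{n+1} ≤ 2^{(n+1)²} · #chains · ∏ |Aᵢ|` (display (9): "define an element
`a ∈ Aₙ` to be popular if `#{x ∈ X : fₙ(x) = a} ≥ #X / (2 #Aₙ)` …"; the printed constant is
`2^{n+1}`, any constant depending only on `n` serves). [cite: KatzTao1999ArithmeticProjections,
Lemma 2.1, proof (pp. 627–628, displays (8)–(9))] -/
theorem card_pow_le_two_pow_mul_card_chains :
    ∀ (n : ℕ) (X : Finset α) (f : Fin n → α → Y) (A : Fin n → Finset Y),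
      (∀ i, ∀ x ∈ X, f i x ∈ A i) →
        X.card ^ (n + 1) ≤ 2 ^ ((n + 1) ^ 2) * ((chains X f).card * ∏ i, (A i).card)
  | 0, X, f, A, _ => by
    rw [card_chains_zero]
    simp only [zero_add, pow_one, Finset.univ_eq_empty, Finset.prod_empty, mul_one, one_pow]
    omega
  | n + 1, X, f, A, hf => by
    -- the last map and its target
    set g : α → Y := f (Fin.last n) with hg
    set A' : Finset Y := A (Fin.last n) with hA'
    have hgA : ∀ x ∈ X, g x ∈ A' := hf (Fin.last n)
    -- fibres of `g` and popular values
    let fib : Y → Finset α := fun a => X.filter fun x => g x = a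
    let Pop : Y → Prop := fun a => X.card ≤ 2 * A'.card * (fib a).card
    let X' : Finset α := X.filter fun x => Pop (g x)
    have hX'X : X' ⊆ X := Finset.filter_subset _ _
    -- (8): `#X' ≥ #X / 2`
    have h8 : X.card ≤ 2 * X'.card := by
      let U : Finset α := X.filter fun x => ¬ Pop (g x)
      have hXU : X'.card + U.card = X.card := Finset.card_filter_add_card_filter_not _
      have hU : U.card = ∑ a ∈ A', (U.filter fun x => g x = a).card :=
        Finset.card_eq_sum_card_fiberwise fun x hx => hgA x (Finset.mem_filter.1 hx).1
      have hterm : ∀ a ∈ A', 2 * A'.card * (U.filter fun x => g x = a).card ≤ X.card - 1 := by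
        intro a _
        by_cases hpa : Pop a
        · have h0 : (U.filter fun x => g x = a) = ∅ := by
            refine Finset.filter_false_of_mem fun x hx => ?_
            rintro rfl
            exact (Finset.mem_filter.1 hx).2 hpa
          rw [h0, Finset.card_empty, mul_zero]
          exact Nat.zero_le _
        · have hsub : (U.filter fun x => g x = a) ⊆ fib a := by
            intro x hx
            rw [Finset.mem_filter] at hx ⊢
            exact ⟨(Finset.mem_filter.1 hx.1).1, hx.2⟩
          have hlt : 2 * A'.card * (fib a).card < X.card := not_le.1 hpa
          have := Nat.mul_le_mul_left (2 * A'.card) (Finset.card_le_card hsub)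
          omega
      have hsum : 2 * A'.card * U.card ≤ A'.card * (X.card - 1) := by
        rw [hU, Finset.mul_sum]
        have := Finset.sum_le_card_nsmul A' _ _ hterm
        simpa using this
      rcases Nat.eq_zero_or_pos A'.card with hA0 | hA0
      · -- no target values: `X` is empty
        have hX0 : X = ∅ := by
          refine Finset.eq_empty_of_forall_notMem fun x hx => ?_
          have := hgA x hx
          rw [Finset.card_eq_zero.1 hA0] at this
          simp at this
        simp [hX0]
      · have h2U : 2 * U.card ≤ X.card - 1 := by
          have : A'.card * (2 * U.card) ≤ A'.card * (X.card - 1) := by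
            calc A'.card * (2 * U.card) = 2 * A'.card * U.card := by ring
              _ ≤ A'.card * (X.card - 1) := hsum
          exact Nat.le_of_mul_le_mul_left this hA0
        omega
    -- the induction hypothesis for `X'` and the first `n` maps
    let f' : Fin n → α → Y := fun i => f (Fin.castSucc i)
    let B : Fin n → Finset Y := fun i => A (Fin.castSucc i)
    have hf' : ∀ i, ∀ x ∈ X', f' i x ∈ B i := fun i x hx => hf (Fin.castSucc i) x (hX'X hx)
    have IH := card_pow_le_two_pow_mul_card_chains n X' f' B hf'
    -- extending a chain of `X'` by a point of the (popular) fibre of its last element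
    have hext : (chains X' f').card * X.card ≤ 2 * A'.card * (chains X f).card := by
      let E := (chains X' f').sigma fun c => fib (g (c (Fin.last n)))
      have hE : E.card = ∑ c ∈ chains X' f', (fib (g (c (Fin.last n)))).card :=
        Finset.card_sigma _ _
      have hEle : E.card ≤ (chains X f).card := by
        refine Finset.card_le_card_of_injOn (fun e => Fin.snoc e.1 e.2) (fun e he => ?_) ?_
        · -- the extended tuple is a chain of `X`
          obtain ⟨hc, hy⟩ := Finset.mem_sigma.1 he
          obtain ⟨hcX', hcf⟩ := mem_chains_iff.1 hc
          obtain ⟨hyX, hyg⟩ := Finset.mem_filter.1 hy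
          refine mem_chains_iff.2 ⟨fun j => ?_, fun i => ?_⟩ <;> dsimp only
          · rcases Fin.eq_castSucc_or_eq_last j with ⟨j', rfl⟩ | rfl
            · rw [Fin.snoc_castSucc]
              exact hX'X (hcX' j')
            · rw [Fin.snoc_last]
              exact hyX
          · rcases Fin.eq_castSucc_or_eq_last i with ⟨i', rfl⟩ | rfl
            · rw [Fin.snoc_castSucc, ← Fin.castSucc_succ, Fin.snoc_castSucc]
              exact hcf i'
            · rw [Fin.snoc_castSucc, Fin.succ_last, Fin.snoc_last]
              exact hyg.symm
        · rintro ⟨c, y⟩ - ⟨c', y'⟩ - h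
          have h1 : c = c' := by
            have := congrArg Fin.init h
            simpa only [Fin.init_snoc] using this
          have h2 : y = y' := by
            have := congrFun h (Fin.last (n + 1))
            simpa only [Fin.snoc_last] using this
          subst h1 h2
          rfl
      have hpop : ∀ c ∈ chains X' f', X.card ≤ 2 * A'.card * (fib (g (c (Fin.last n)))).card :=
        fun c hc => (Finset.mem_filter.1 ((mem_chains_iff.1 hc).1 (Fin.last n))).2
      calc (chains X' f').card * X.card = ∑ c ∈ chains X' f', X.card := by
            rw [Finset.sum_const, smul_eq_mul]
        _ ≤ ∑ c ∈ chains X' f', 2 * A'.card * (fib (g (c (Fin.last n)))).card :=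
            Finset.sum_le_sum hpop
        _ = 2 * A'.card * E.card := by rw [hE, Finset.mul_sum]
        _ ≤ 2 * A'.card * (chains X f).card := Nat.mul_le_mul_left _ hEle
    -- assembling the constants
    have hprod : ∏ i, (A i).card = (∏ i, (B i).card) * A'.card := Fin.prod_univ_castSucc _
    have hK : 2 ^ (n + 1) * 2 * 2 ^ ((n + 1) ^ 2) ≤ 2 ^ ((n + 1 + 1) ^ 2) := by
      rw [← pow_succ, ← pow_add]
      exact Nat.pow_le_pow_right (by norm_num) (by nlinarith)
    calc X.card ^ (n + 1 + 1) = X.card ^ (n + 1) * X.card := pow_succ _ _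
      _ ≤ (2 * X'.card) ^ (n + 1) * X.card := by gcongr
      _ = 2 ^ (n + 1) * (X'.card ^ (n + 1) * X.card) := by ring
      _ ≤ 2 ^ (n + 1) * (2 ^ ((n + 1) ^ 2) * ((chains X' f').card * ∏ i, (B i).card)
          * X.card) := by gcongr
      _ = 2 ^ (n + 1) * 2 ^ ((n + 1) ^ 2) * (∏ i, (B i).card)
          * ((chains X' f').card * X.card) := by ring
      _ ≤ 2 ^ (n + 1) * 2 ^ ((n + 1) ^ 2) * (∏ i, (B i).card)
          * (2 * A'.card * (chains X f).card) := by gcongr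
      _ = 2 ^ (n + 1) * 2 * 2 ^ ((n + 1) ^ 2)
          * ((chains X f).card * ((∏ i, (B i).card) * A'.card)) := by ring
      _ ≤ 2 ^ ((n + 1 + 1) ^ 2) * ((chains X f).card * ∏ i, (A i).card) := by
          rw [hprod]
          exact Nat.mul_le_mul_right _ hK

/-- The `M`-th Cartesian power of a map: `(x₁, …, x_M) ↦ (f x₁, …, f x_M)` ("`fᵢ` replaced with
the function `fᵢ^M : X^M → Aᵢ^M`", p. 628). [cite: KatzTao1999ArithmeticProjections, Lemma 2.1,
proof (p. 628)] -/
def powMap (M : ℕ) (f : α → Y) : (Fin M → α) → (Fin M → Y) := fun x m => f (x m)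

/-- **The chains of the `M`-th power are the `M`-tuples of chains**: transposition is a bijection,
so `#chains(X^M, f^M) = (#chains(X, f))^M`. [cite: KatzTao1999ArithmeticProjections, Lemma 2.1,
proof (p. 628: "to eliminate the factor … we let `M` be a large integer")] -/
theorem card_chains_pow (X : Finset α) (f : Fin n → α → Y) (M : ℕ) :
    (chains (Fintype.piFinset fun _ : Fin M => X) (fun i => powMap M (f i))).card =
      (chains X f).card ^ M := by
  rw [← Fintype.card_piFinset_const]
  refine Finset.card_nbij' (fun x m j => x j m) (fun d j m => d m j) (fun x hx => ?_)
    (fun d hd => ?_) (fun _ _ => rfl) (fun _ _ => rfl)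
  · obtain ⟨hX, hf⟩ := mem_chains_iff.1 (Finset.mem_coe.1 hx)
    refine Finset.mem_coe.2 (Fintype.mem_piFinset.2 fun m => mem_chains_iff.2 ⟨fun j => ?_, fun i => ?_⟩)
    · exact Fintype.mem_piFinset.1 (hX j) m
    · exact congrFun (hf i) m
  · have hd' := fun m => mem_chains_iff.1 (Fintype.mem_piFinset.1 (Finset.mem_coe.1 hd) m)
    refine Finset.mem_coe.2 (mem_chains_iff.2 ⟨fun j => Fintype.mem_piFinset.2 fun m => (hd' m).1 j,
      fun i => funext fun m => (hd' m).2 i⟩)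

/-- The tensor-power trick in numbers: if `a^M ≤ K c^M` for every `M`, then `a ≤ c`. [folklore] -/
private theorem le_of_pow_le_mul_pow {a c K : ℕ} (h : ∀ M : ℕ, a ^ M ≤ K * c ^ M) : a ≤ c := by
  by_contra hlt
  rw [not_le] at hlt
  rcases Nat.eq_zero_or_pos c with h0 | hpos
  · have h1 := h 1
    rw [h0, pow_one, pow_one, mul_zero, Nat.le_zero] at h1
    omega
  · have ht : (1 : ℝ) < (a : ℝ) / c := by
      rw [lt_div_iff₀ (Nat.cast_pos.2 hpos), one_mul]
      exact_mod_cast hlt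
    obtain ⟨M, hM'⟩ := pow_unbounded_of_one_lt (K : ℝ) ht
    have hcM : (0 : ℝ) < (c : ℝ) ^ M := pow_pos (Nat.cast_pos.2 hpos) M
    rw [div_pow, lt_div_iff₀ hcM] at hM'
    have h' : (a : ℝ) ^ M ≤ (K : ℝ) * (c : ℝ) ^ M := by exact_mod_cast h M
    exact absurd h' (not_le.2 hM')

/-- **Lemma 2.1 (Katz–Tao), exactly as printed, in integers.** "Let `X` and `A₁, …, Aₙ` be finite
sets for some `n ≥ 0`, and for each `1 ≤ i ≤ n` let `fᵢ : X → Aᵢ` be a function. Then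
`#{(x₀, …, xₙ) ∈ X^{n+1} : fᵢ(x_{i−1}) = fᵢ(xᵢ) for all 1 ≤ i ≤ n} ≥ (#X)^{n+1} / ∏ᵢ #Aᵢ`."
Here the `Aᵢ` are finite subsets of one ambient type `Y` receiving the values of `fᵢ` on `X`
(equivalent to the printed form: embed `A₁ ⊔ ⋯ ⊔ Aₙ` in one set), and the inequality is cleared
of its denominator.  Proof as printed: the lossy bound `card_pow_le_two_pow_mul_card_chains`
applied to the Cartesian powers `X^M`, `fᵢ^M`, `Aᵢ^M`, whose chain count is the `M`-th power
(`card_chains_pow`), gives `(#X^{n+1})^M ≤ 2^{(n+1)²} (#chains · ∏ #Aᵢ)^M` for every `M`, and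
`M → ∞` removes the constant. [cite: KatzTao1999ArithmeticProjections, Lemma 2.1 (p. 627,
display (7)); proof pp. 627–628] -/
theorem card_pow_le_card_chains_mul_prod (X : Finset α) (f : Fin n → α → Y)
    (A : Fin n → Finset Y) (hf : ∀ i, ∀ x ∈ X, f i x ∈ A i) :
    X.card ^ (n + 1) ≤ (chains X f).card * ∏ i, (A i).card := by
  refine le_of_pow_le_mul_pow (K := 2 ^ ((n + 1) ^ 2)) fun M => ?_
  have h := card_pow_le_two_pow_mul_card_chains n (Fintype.piFinset fun _ : Fin M => X)
    (fun i => powMap M (f i)) (fun i => Fintype.piFinset fun _ : Fin M => A i) fun i x hx =>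
      Fintype.mem_piFinset.2 fun m => hf i (x m) (Fintype.mem_piFinset.1 hx m)
  rw [Fintype.card_piFinset_const, card_chains_pow] at h
  simp only [Fintype.card_piFinset_const] at h
  rw [Finset.prod_pow, ← mul_pow, ← pow_mul, mul_comm M (n + 1), pow_mul] at h
  exact h

/-- **Lemma 2.1 exactly as printed (display (7)), over `ℝ`:**
`#chains ≥ (#X)^{n+1} / ∏ᵢ #Aᵢ`. [cite: KatzTao1999ArithmeticProjections, Lemma 2.1 (p. 627,
display (7))] -/
theorem card_pow_div_prod_le_card_chains (X : Finset α) (f : Fin n → α → Y)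
    (A : Fin n → Finset Y) (hf : ∀ i, ∀ x ∈ X, f i x ∈ A i) :
    (X.card : ℝ) ^ (n + 1) / ∏ i, ((A i).card : ℝ) ≤ (chains X f).card := by
  rcases eq_or_ne (∏ i, ((A i).card : ℝ)) 0 with h0 | h0
  · rw [h0, div_zero]
    exact Nat.cast_nonneg _
  · rw [div_le_iff₀ (lt_of_le_of_ne (Finset.prod_nonneg fun i _ => Nat.cast_nonneg _) h0.symm)]
    exact_mod_cast card_pow_le_card_chains_mul_prod X f A hf

end CombinatorialLemma

section Vertical

/-! ### Theorem 1.1 — the set `V` of display (12) (no group structure needed) -/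

variable {Z : Type*} [DecidableEq Z]

/-- **(12): `V = {(a, b, b′) ∈ A × B × B : (a, b), (a, b′) ∈ G}`** — the pairs of elements of
`G` with the same first coordinate ("vertical" pairs). [cite: KatzTao1999ArithmeticProjections,
§3 display (12) (p. 628)] -/
def vert (G : Finset (Z × Z)) : Finset (Z × Z × Z) :=
  ((G ×ˢ G).filter fun q => q.1.1 = q.2.1).image fun q => (q.1.1, q.1.2, q.2.2)

/-- Membership in `V`: `(a, b, b′) ∈ V ↔ (a, b) ∈ G ∧ (a, b′) ∈ G`.
[cite: KatzTao1999ArithmeticProjections, §3 display (12) (p. 628)] -/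
theorem mem_vert_iff {G : Finset (Z × Z)} {v : Z × Z × Z} :
    v ∈ vert G ↔ (v.1, v.2.1) ∈ G ∧ (v.1, v.2.2) ∈ G := by
  constructor
  · intro hv
    obtain ⟨q, hq, rfl⟩ := Finset.mem_image.1 hv
    obtain ⟨hqG, hq1⟩ := Finset.mem_filter.1 hq
    obtain ⟨h1, h2⟩ := Finset.mem_product.1 hqG
    refine ⟨by simpa using h1, ?_⟩
    rw [hq1]
    simpa using h2
  · rintro ⟨h1, h2⟩
    refine Finset.mem_image.2 ⟨((v.1, v.2.1), (v.1, v.2.2)), ?_, ?_⟩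
    · exact Finset.mem_filter.2 ⟨Finset.mem_product.2 ⟨h1, h2⟩, rfl⟩
    · simp

/-- **(13): `#V ≥ (#G)²/N` — "by applying (7) with `n = 1` and `f₁ : G → A` being the projection
map"**; precisely `(#G)² ≤ #V · #A` for `G ⊆ A × B`. [cite: KatzTao1999ArithmeticProjections, §3
display (13) (p. 628)] -/
theorem card_sq_le_card_vert_mul {A B : Finset Z} {G : Finset (Z × Z)} (hG : G ⊆ A ×ˢ B) :
    G.card ^ 2 ≤ (vert G).card * A.card := by
  have h := card_pow_le_card_chains_mul_prod G ![(Prod.fst : Z × Z → Z)] ![A] fun i p hp => by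
    fin_cases i
    exact (Finset.mem_product.1 (hG hp)).1
  rw [Fin.prod_univ_one, Matrix.cons_val_zero] at h
  refine h.trans (le_of_eq ?_)
  congr 1
  -- the chains `(x₀, x₁) ∈ G²` with `x₀.1 = x₁.1` are the triples of `V`
  refine Finset.card_nbij' (fun x => ((x 0).1, (x 0).2, (x 1).2))
    (fun v => ![(v.1, v.2.1), (v.1, v.2.2)]) (fun x hx => ?_) (fun v hv => ?_) (fun x hx => ?_)
    (fun v _ => ?_)
  · obtain ⟨hxG, hxf⟩ := mem_chains_iff.1 (Finset.mem_coe.1 hx)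
    have h01 : (x 0).1 = (x 1).1 := hxf 0
    refine Finset.mem_coe.2 (mem_vert_iff.2 ⟨by simpa using hxG 0, ?_⟩)
    dsimp only
    rw [h01]
    simpa using hxG 1
  · obtain ⟨h1, h2⟩ := mem_vert_iff.1 (Finset.mem_coe.1 hv)
    refine Finset.mem_coe.2 (mem_chains_iff.2 ⟨fun j => ?_, fun i => ?_⟩)
    · fin_cases j
      · simpa using h1
      · simpa using h2
    · fin_cases i
      rfl
  · obtain ⟨-, hxf⟩ := mem_chains_iff.1 (Finset.mem_coe.1 hx)
    have h01 : (x 0).1 = (x 1).1 := hxf 0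
    funext j
    fin_cases j
    · simp
    · simp [h01]
  · simp

/-- The map `f₂(a, b, b′) = (b, b′)` of §3 (into `B × B`).
[cite: KatzTao1999ArithmeticProjections, §3 (p. 628)] -/
def mapF₂ (v : Z × Z × Z) : Z × Z := (v.2.1, v.2.2)

end Vertical

section SumsAndDifferences

/-! ### Theorem 1.1 — sums, differences and the sets `G ⊂ A × B` -/

variable {Z : Type*} [AddCommGroup Z] [DecidableEq Z]

/-- `C = {a + b : (a, b) ∈ G}` (display (3)). [cite: KatzTao1999ArithmeticProjections, §1
display (3) (p. 625)] -/
def sums (G : Finset (Z × Z)) : Finset Z := G.image fun p => p.1 + p.2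

/-- `{a − b : (a, b) ∈ G}` — the quantity (2) is its cardinality.
[cite: KatzTao1999ArithmeticProjections, §1 display (2) (p. 625)] -/
def diffs (G : Finset (Z × Z)) : Finset Z := G.image fun p => p.1 - p.2

/-- `D = {a + 2b : (a, b) ∈ G}` (display (5)). [cite: KatzTao1999ArithmeticProjections, §1
display (5) (p. 625)] -/
def sumsTwo (G : Finset (Z × Z)) : Finset Z := G.image fun p => p.1 + 2 • p.2

/-- `sums` is monotone. [folklore] -/
private theorem sums_mono {G G' : Finset (Z × Z)} (h : G' ⊆ G) : sums G' ⊆ sums G :=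
  Finset.image_subset_image h

/-- `sumsTwo` is monotone. [folklore] -/
private theorem sumsTwo_mono {G G' : Finset (Z × Z)} (h : G' ⊆ G) : sumsTwo G' ⊆ sumsTwo G :=
  Finset.image_subset_image h

/-- **(10): "By removing redundant elements of `G`, we may assume the map `(a, b) ↦ a − b` is
one-to-one on `G`"** — a subset `G' ⊆ G` on which subtraction is injective and which has exactly
`#{a − b : (a, b) ∈ G}` elements. [cite: KatzTao1999ArithmeticProjections, §3 display (10)
(p. 628)] -/
theorem exists_subset_injOn_card_eq (G : Finset (Z × Z)) :
    ∃ G' ⊆ G, Set.InjOn (fun p : Z × Z => p.1 - p.2) ↑G' ∧ G'.card = (diffs G).card := by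
  classical
  have h : ∀ d ∈ diffs G, ∃ p ∈ G, p.1 - p.2 = d := fun d hd => by
    simpa [diffs] using hd
  choose! σ hσG hσ using h
  refine ⟨(diffs G).image σ, ?_, ?_, ?_⟩
  · intro p hp
    obtain ⟨d, hd, rfl⟩ := Finset.mem_image.1 hp
    exact hσG d hd
  · rintro p hp q hq hpq
    obtain ⟨d, hd, rfl⟩ := Finset.mem_image.1 (Finset.mem_coe.1 hp)
    obtain ⟨d', hd', rfl⟩ := Finset.mem_image.1 (Finset.mem_coe.1 hq)
    have : d = d' := by rw [← hσ d hd, ← hσ d' hd']; exact hpq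
    rw [this]
  · refine Finset.card_image_of_injOn fun d hd d' hd' h => ?_
    rw [← hσ d (Finset.mem_coe.1 hd), ← hσ d' (Finset.mem_coe.1 hd'), h]

/-- The map `f₁(a, b, b′) = (a + b, a + b′)` of §3 (into `C × C`).
[cite: KatzTao1999ArithmeticProjections, §3 (p. 628)] -/
def mapF₁ (v : Z × Z × Z) : Z × Z := (v.1 + v.2.1, v.1 + v.2.2)

/-- The map `f₃(a, b, b′) = (a + b, b′)` of §3 (into `C × B`).
[cite: KatzTao1999ArithmeticProjections, §3 (p. 628)] -/
def mapF₃ (v : Z × Z × Z) : Z × Z := (v.1 + v.2.1, v.2.2)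

/-- **`S = {(v₀, v₁, v₂, v₃) ∈ V⁴ : f₁(v₀) = f₁(v₁), f₂(v₁) = f₂(v₂), f₃(v₂) = f₃(v₃)}`** (§3).
[cite: KatzTao1999ArithmeticProjections, §3 (p. 628)] -/
def ess (G : Finset (Z × Z)) : Finset (Fin 4 → Z × Z × Z) :=
  chains (vert G) ![mapF₁, mapF₂, mapF₃]

/-- **(14): `#S ≥ (#V)⁴/N⁶` — "from (7), (1) and (3)"**; precisely
`(#V)⁴ ≤ #S · (#C)² (#B)² (#C · #B)`. [cite: KatzTao1999ArithmeticProjections, §3 display (14)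
(p. 628)] -/
theorem card_vert_pow_four_le {A B : Finset Z} {G : Finset (Z × Z)} (hG : G ⊆ A ×ˢ B) :
    (vert G).card ^ 4 ≤ (ess G).card *
      (((sums G).card * (sums G).card) * (B.card * B.card) * ((sums G).card * B.card)) := by
  have hB : ∀ p ∈ G, p.2 ∈ B := fun p hp => (Finset.mem_product.1 (hG hp)).2
  have hC : ∀ p ∈ G, p.1 + p.2 ∈ sums G := fun p hp => Finset.mem_image.2 ⟨p, hp, rfl⟩
  have h : (vert G).card ^ (3 + 1) ≤ (ess G).card *
      ∏ i, (![sums G ×ˢ sums G, B ×ˢ B, sums G ×ˢ B] i).card :=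
    card_pow_le_card_chains_mul_prod (vert G) ![mapF₁, mapF₂, mapF₃]
    ![sums G ×ˢ sums G, B ×ˢ B, sums G ×ˢ B] fun i v hv => by
    obtain ⟨h1, h2⟩ := mem_vert_iff.1 hv
    fin_cases i
    · show mapF₁ v ∈ sums G ×ˢ sums G
      exact Finset.mem_product.2 ⟨hC (v.1, v.2.1) h1, hC (v.1, v.2.2) h2⟩
    · show mapF₂ v ∈ B ×ˢ B
      exact Finset.mem_product.2 ⟨hB (v.1, v.2.1) h1, hB (v.1, v.2.2) h2⟩
    · show mapF₃ v ∈ sums G ×ˢ B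
      exact Finset.mem_product.2 ⟨hC (v.1, v.2.1) h1, hB (v.1, v.2.2) h2⟩
  have hprod : ∏ i, (![sums G ×ˢ sums G, B ×ˢ B, sums G ×ˢ B] i).card =
      ((sums G).card * (sums G).card) * (B.card * B.card) * ((sums G).card * B.card) := by
    simp [Fin.prod_univ_three, Finset.card_product]
  rw [hprod] at h
  exact h

/-- The relations defining `S`, unpacked. [folklore] -/
private theorem ess_spec {G : Finset (Z × Z)} {s : Fin 4 → Z × Z × Z} (hs : s ∈ ess G) :
    (∀ j, s j ∈ vert G) ∧
      ((s 0).1 + (s 0).2.1 = (s 1).1 + (s 1).2.1 ∧ (s 0).1 + (s 0).2.2 = (s 1).1 + (s 1).2.2) ∧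
      ((s 1).2.1 = (s 2).2.1 ∧ (s 1).2.2 = (s 2).2.2) ∧
      ((s 2).1 + (s 2).2.1 = (s 3).1 + (s 3).2.1 ∧ (s 2).2.2 = (s 3).2.2) := by
  obtain ⟨hV, hc⟩ := mem_chains_iff.1 hs
  have h0 : mapF₁ (s 0) = mapF₁ (s 1) := hc 0
  have h1 : mapF₂ (s 1) = mapF₂ (s 2) := hc 1
  have h2 : mapF₃ (s 2) = mapF₃ (s 3) := hc 2
  simp only [mapF₁, mapF₂, mapF₃, Prod.mk.injEq] at h0 h1 h2
  exact ⟨hV, h0, h1, h2⟩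

/-- **The key identity of §3: `a₃ − b₃′ = a₂ − b₃ + b₀ − b₀′` on `S`** (p. 629: "Combining
these equations, we obtain `a₃ − b₃′ = a₂ − b₃ + b₀ − b₀′`. Thus `a₃ − b₃′` is determined by
`(v₀, a₂, b₃)`"). [cite: KatzTao1999ArithmeticProjections, §3 (p. 629)] -/
theorem ess_key {G : Finset (Z × Z)} {s : Fin 4 → Z × Z × Z} (hs : s ∈ ess G) :
    (s 3).1 - (s 3).2.2 = (s 2).1 - (s 3).2.1 + ((s 0).2.1 - (s 0).2.2) := by
  obtain ⟨-, ⟨e1, e2⟩, ⟨e3, e4⟩, ⟨e5, e6⟩⟩ := ess_spec hs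
  have k : (s 1).2.1 - (s 1).2.2 = (s 0).2.1 - (s 0).2.2 := by
    have := congrArg₂ (· - ·) e1 e2
    simp only [add_sub_add_left_eq_sub] at this
    exact this.symm
  have ha3 : (s 3).1 = (s 2).1 + (s 2).2.1 - (s 3).2.1 := eq_sub_of_add_eq e5.symm
  rw [ha3, ← e6, ← k, ← e3, ← e4]
  abel

/-- **"`g` is injective": `#S ≤ N² #V`** — the map `g(v₀, v₁, v₂, v₃) = (v₀, a₂, b₃)` is
injective on `S` when subtraction is injective on `G`, so `#S ≤ #V · #A · #B`.
[cite: KatzTao1999ArithmeticProjections, §3 (pp. 628–629)] -/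
theorem card_ess_le {A B : Finset Z} {G : Finset (Z × Z)} (hG : G ⊆ A ×ˢ B)
    (hinj : Set.InjOn (fun p : Z × Z => p.1 - p.2) ↑G) :
    (ess G).card ≤ (vert G).card * (A.card * B.card) := by
  rw [← Finset.card_product, ← Finset.card_product]
  refine Finset.card_le_card_of_injOn (fun s => (s 0, (s 2).1, (s 3).2.1)) (fun s hs => ?_)
    (fun s hs t ht hst => ?_)
  · obtain ⟨hV, -⟩ := ess_spec (Finset.mem_coe.1 hs)
    refine Finset.mem_coe.2 (Finset.mem_product.2 ⟨hV 0, Finset.mem_product.2 ⟨?_, ?_⟩⟩)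
    · exact (Finset.mem_product.1 (hG (mem_vert_iff.1 (hV 2)).1)).1
    · exact (Finset.mem_product.1 (hG (mem_vert_iff.1 (hV 3)).1)).2
  · have hs' := Finset.mem_coe.1 hs
    have ht' := Finset.mem_coe.1 ht
    obtain ⟨hVs, ⟨s1, s2⟩, ⟨s3, s4⟩, ⟨s5, s6⟩⟩ := ess_spec hs'
    obtain ⟨hVt, ⟨t1, t2⟩, ⟨t3, t4⟩, ⟨t5, t6⟩⟩ := ess_spec ht'
    simp only [Prod.mk.injEq] at hst
    obtain ⟨h0, ha2, hb3⟩ := hst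
    -- `a₃ − b₃′` agrees, hence `(a₃, b₃′)` agrees
    have hd : (s 3).1 - (s 3).2.2 = (t 3).1 - (t 3).2.2 := by
      rw [ess_key hs', ess_key ht', h0, ha2, hb3]
    have h3 : ((s 3).1, (s 3).2.2) = ((t 3).1, (t 3).2.2) :=
      hinj (mem_vert_iff.1 (hVs 3)).2 (mem_vert_iff.1 (hVt 3)).2 hd
    simp only [Prod.mk.injEq] at h3
    obtain ⟨ha3, hb3'⟩ := h3
    -- now everything is determined: `v₂` from (16), then `v₁` from (15)
    have hb2' : (s 2).2.2 = (t 2).2.2 := by rw [s6, t6, hb3']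
    have hb2 : (s 2).2.1 = (t 2).2.1 := by
      have es : (s 2).2.1 = (s 3).1 + (s 3).2.1 - (s 2).1 := eq_sub_of_add_eq' s5
      have et : (t 2).2.1 = (t 3).1 + (t 3).2.1 - (t 2).1 := eq_sub_of_add_eq' t5
      rw [es, et, ha3, hb3, ha2]
    have hb1 : (s 1).2.1 = (t 1).2.1 := by rw [s3, t3, hb2]
    have hb1' : (s 1).2.2 = (t 1).2.2 := by rw [s4, t4, hb2']
    have ha1 : (s 1).1 = (t 1).1 := by
      have es : (s 1).1 = (s 0).1 + (s 0).2.1 - (s 1).2.1 := eq_sub_of_add_eq s1.symm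
      have et : (t 1).1 = (t 0).1 + (t 0).2.1 - (t 1).2.1 := eq_sub_of_add_eq t1.symm
      rw [es, et, h0, hb1]
    funext j
    fin_cases j
    · exact h0
    · exact Prod.ext ha1 (Prod.ext hb1 hb1')
    · exact Prod.ext ha2 (Prod.ext hb2 hb2')
    · exact Prod.ext ha3 (Prod.ext hb3 hb3')

/-- **Theorem 1.1, display (4), for `G` on which subtraction is injective: `#G ≤ N^{11/6}`**
(display (11)), in integers `(#G)⁶ ≤ N¹¹`: from (13) `(#G)² ≤ N #V`, (14) `(#V)⁴ ≤ N⁶ #S` and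
`#S ≤ N² #V`, so `#V ≤ N^{8/3}`. [cite: KatzTao1999ArithmeticProjections, Thm 1.1 (4) / §3
display (11) (pp. 625, 628–629)] -/
theorem card_pow_six_le_of_injOn {A B : Finset Z} {G : Finset (Z × Z)} (hG : G ⊆ A ×ˢ B)
    (hinj : Set.InjOn (fun p : Z × Z => p.1 - p.2) ↑G) {N : ℕ} (hA : A.card ≤ N)
    (hB : B.card ≤ N) (hC : (sums G).card ≤ N) : G.card ^ 6 ≤ N ^ 11 := by
  set V := (vert G).card with hVdef
  have h13 : G.card ^ 2 ≤ V * N :=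
    (card_sq_le_card_vert_mul hG).trans (Nat.mul_le_mul_left _ hA)
  have h14 : V ^ 4 ≤ V * N ^ 8 := by
    calc V ^ 4 ≤ (ess G).card * (((sums G).card * (sums G).card) * (B.card * B.card)
          * ((sums G).card * B.card)) := card_vert_pow_four_le hG
      _ ≤ (V * (A.card * B.card)) * ((N * N) * (N * N) * (N * N)) := by
          gcongr
          exact card_ess_le hG hinj
      _ ≤ (V * (N * N)) * ((N * N) * (N * N) * (N * N)) := by gcongr
      _ = V * N ^ 8 := by ring
  rcases Nat.eq_zero_or_pos V with hV0 | hVpos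
  · rw [hV0, zero_mul, Nat.le_zero, pow_eq_zero_iff two_ne_zero] at h13
    simp [h13]
  · have h3 : V ^ 3 ≤ N ^ 8 := by
      rw [show V ^ 4 = V * V ^ 3 by ring] at h14
      exact Nat.le_of_mul_le_mul_left h14 hVpos
    calc G.card ^ 6 = (G.card ^ 2) ^ 3 := by ring
      _ ≤ (V * N) ^ 3 := Nat.pow_le_pow_left h13 3
      _ = V ^ 3 * N ^ 3 := by ring
      _ ≤ N ^ 8 * N ^ 3 := Nat.mul_le_mul_right _ h3
      _ = N ^ 11 := by ring

/-- **Theorem 1.1 (Katz–Tao 1999), display (4), in integers.**  Let `Z` be an abelian group,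
`A, B ⊆ Z` finite with `#A, #B ≤ N`, and `G ⊆ A × B` with `#{a + b : (a, b) ∈ G} ≤ N`; then
`#{a − b : (a, b) ∈ G}⁶ ≤ N¹¹`.  (The paper assumes `Z` torsion-free; the printed proof, followed
here, uses no such hypothesis.) [cite: KatzTao1999ArithmeticProjections, Thm 1.1 (4) (p. 625)] -/
theorem card_diffs_pow_six_le {A B : Finset Z} {G : Finset (Z × Z)} (hG : G ⊆ A ×ˢ B) {N : ℕ}
    (hA : A.card ≤ N) (hB : B.card ≤ N) (hC : (sums G).card ≤ N) :
    (diffs G).card ^ 6 ≤ N ^ 11 := by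
  obtain ⟨G', hG'G, hinj, hcard⟩ := exists_subset_injOn_card_eq G
  rw [← hcard]
  exact card_pow_six_le_of_injOn (hG'G.trans hG) hinj hA hB
    ((Finset.card_le_card (sums_mono hG'G)).trans hC)

/-- From `d^k ≤ N^m` to `d ≤ N^{m/k}` over `ℝ`. [folklore] -/
private theorem le_rpow_of_pow_le_pow {d N k m : ℕ} (hk : k ≠ 0) (h : d ^ k ≤ N ^ m) :
    (d : ℝ) ≤ (N : ℝ) ^ ((m : ℝ) / k) := by
  have h' : ((d : ℝ) ^ k) ≤ (N : ℝ) ^ m := by exact_mod_cast h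
  have hk0 : (0 : ℝ) ≤ (k : ℝ)⁻¹ := by positivity
  have := Real.rpow_le_rpow (pow_nonneg (Nat.cast_nonneg _) _) h' hk0
  rw [Real.pow_rpow_inv_natCast (Nat.cast_nonneg _) hk, ← Real.rpow_natCast (N : ℝ) m,
    ← Real.rpow_mul (Nat.cast_nonneg _)] at this
  rwa [div_eq_mul_inv]

/-- **Theorem 1.1 (Katz–Tao 1999), display (4), exactly as printed: under (1) `#A, #B ≤ N` and
(3) `#{a + b : (a, b) ∈ G} ≤ N`, the number (2) of differences satisfies
`#{a − b : (a, b) ∈ G} ≤ N^{2 − 1/6}`.** [cite: KatzTao1999ArithmeticProjections, Thm 1.1 (4)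
(p. 625)] -/
theorem card_diffs_le_rpow {A B : Finset Z} {G : Finset (Z × Z)} (hG : G ⊆ A ×ˢ B) {N : ℕ}
    (hA : A.card ≤ N) (hB : B.card ≤ N) (hC : (sums G).card ≤ N) :
    ((diffs G).card : ℝ) ≤ (N : ℝ) ^ (2 - 1 / 6 : ℝ) := by
  have h := le_rpow_of_pow_le_pow (by norm_num) (card_diffs_pow_six_le hG hA hB hC)
  norm_num at h ⊢
  exact h

/-! ### Theorem 1.1, display (6): the further assumption `#{a + 2b} ≤ N` -/

/-- The map `f₁(a, b, b′) = (a + 2b, b′)` of §4 (into `D × B`).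
[cite: KatzTao1999ArithmeticProjections, §4 (p. 629)] -/
def mapF₄ (v : Z × Z × Z) : Z × Z := (v.1 + 2 • v.2.1, v.2.2)

/-- **`T = {(v₀, v₁) ∈ V² : f₁(v₀) = f₁(v₁)}`** (§4). [cite: KatzTao1999ArithmeticProjections, §4
(p. 629)] -/
def tee (G : Finset (Z × Z)) : Finset (Fin 2 → Z × Z × Z) :=
  chains (vert G) ![mapF₄]

/-- **(18): `#T ≥ (#V)²/N²` — "from (7), (1), (5)"**; precisely `(#V)² ≤ #T · (#D · #B)`.
[cite: KatzTao1999ArithmeticProjections, §4 display (18) (p. 629)] -/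
theorem card_vert_sq_le {A B : Finset Z} {G : Finset (Z × Z)} (hG : G ⊆ A ×ˢ B) :
    (vert G).card ^ 2 ≤ (tee G).card * ((sumsTwo G).card * B.card) := by
  have hB : ∀ p ∈ G, p.2 ∈ B := fun p hp => (Finset.mem_product.1 (hG hp)).2
  have hD : ∀ p ∈ G, p.1 + 2 • p.2 ∈ sumsTwo G := fun p hp => Finset.mem_image.2 ⟨p, hp, rfl⟩
  have h : (vert G).card ^ (1 + 1) ≤ (tee G).card * ∏ i, (![sumsTwo G ×ˢ B] i).card :=
    card_pow_le_card_chains_mul_prod (vert G) ![mapF₄] ![sumsTwo G ×ˢ B] fun i v hv => by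
    obtain ⟨h1, h2⟩ := mem_vert_iff.1 hv
    fin_cases i
    show mapF₄ v ∈ sumsTwo G ×ˢ B
    exact Finset.mem_product.2 ⟨hD (v.1, v.2.1) h1, hB (v.1, v.2.2) h2⟩
  have hprod : ∏ i, (![sumsTwo G ×ˢ B] i).card = (sumsTwo G).card * B.card := by
    simp [Finset.card_product]
  rw [hprod] at h
  exact h

/-- The relations defining `T`, unpacked: (19) `a₀ + 2b₀ = a₁ + 2b₁`, `b₀′ = b₁′`. [folklore] -/
private theorem tee_spec {G : Finset (Z × Z)} {t : Fin 2 → Z × Z × Z} (ht : t ∈ tee G) :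
    (∀ j, t j ∈ vert G) ∧
      (t 0).1 + 2 • (t 0).2.1 = (t 1).1 + 2 • (t 1).2.1 ∧ (t 0).2.2 = (t 1).2.2 := by
  obtain ⟨hV, hc⟩ := mem_chains_iff.1 ht
  have h0 : mapF₄ (t 0) = mapF₄ (t 1) := hc 0
  simp only [mapF₄, Prod.mk.injEq] at h0
  exact ⟨hV, h0⟩

/-- **The key identity of §4: `a₁ − b₁′ = 2(a₀ + b₀) − 2b₁ − (a₀ + b₀′)` on `T`** (p. 629:
"Thus `a₁ − b₁′` is determined by `h(v₀, v₁)`"; primes as reconstructed in the module docstring).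
[cite: KatzTao1999ArithmeticProjections, §4 (p. 629)] -/
theorem tee_key {G : Finset (Z × Z)} {t : Fin 2 → Z × Z × Z} (ht : t ∈ tee G) :
    (t 1).1 - (t 1).2.2 = 2 • ((t 0).1 + (t 0).2.1) - 2 • (t 1).2.1 - ((t 0).1 + (t 0).2.2) := by
  obtain ⟨-, e1, e2⟩ := tee_spec ht
  have ha1 : (t 1).1 = (t 0).1 + 2 • (t 0).2.1 - 2 • (t 1).2.1 := eq_sub_of_add_eq e1.symm
  rw [ha1, ← e2, smul_add]
  abel

/-- **"`h` is injective": `#T ≤ N³`** — the map `h(v₀, v₁) = (a₀ + b₀, a₀ + b₀′, b₁)` is injective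
on `T` when subtraction is injective on `G`, so `#T ≤ #C · #C · #B`.
[cite: KatzTao1999ArithmeticProjections, §4 (pp. 629–630)] -/
theorem card_tee_le {A B : Finset Z} {G : Finset (Z × Z)} (hG : G ⊆ A ×ˢ B)
    (hinj : Set.InjOn (fun p : Z × Z => p.1 - p.2) ↑G) :
    (tee G).card ≤ (sums G).card * ((sums G).card * B.card) := by
  have hB : ∀ p ∈ G, p.2 ∈ B := fun p hp => (Finset.mem_product.1 (hG hp)).2
  have hC : ∀ p ∈ G, p.1 + p.2 ∈ sums G := fun p hp => Finset.mem_image.2 ⟨p, hp, rfl⟩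
  rw [← Finset.card_product, ← Finset.card_product]
  refine Finset.card_le_card_of_injOn
    (fun t => ((t 0).1 + (t 0).2.1, (t 0).1 + (t 0).2.2, (t 1).2.1)) (fun t ht => ?_)
    (fun t ht u hu htu => ?_)
  · obtain ⟨hV, -⟩ := tee_spec (Finset.mem_coe.1 ht)
    obtain ⟨h01, h02⟩ := mem_vert_iff.1 (hV 0)
    refine Finset.mem_coe.2 (Finset.mem_product.2
      ⟨hC ((t 0).1, (t 0).2.1) h01, Finset.mem_product.2 ⟨hC ((t 0).1, (t 0).2.2) h02, ?_⟩⟩)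
    exact hB ((t 1).1, (t 1).2.1) (mem_vert_iff.1 (hV 1)).1
  · have ht' := Finset.mem_coe.1 ht
    have hu' := Finset.mem_coe.1 hu
    obtain ⟨hVt, t1, t2⟩ := tee_spec ht'
    obtain ⟨hVu, u1, u2⟩ := tee_spec hu'
    simp only [Prod.mk.injEq] at htu
    obtain ⟨hs, hs', hb1⟩ := htu
    -- `a₁ − b₁′` agrees, hence `(a₁, b₁′)` agrees
    have hd : (t 1).1 - (t 1).2.2 = (u 1).1 - (u 1).2.2 := by
      rw [tee_key ht', tee_key hu', hs, hs', hb1]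
    have h1 : ((t 1).1, (t 1).2.2) = ((u 1).1, (u 1).2.2) :=
      hinj (mem_vert_iff.1 (hVt 1)).2 (mem_vert_iff.1 (hVu 1)).2 hd
    simp only [Prod.mk.injEq] at h1
    obtain ⟨ha1, hb1'⟩ := h1
    have hb0' : (t 0).2.2 = (u 0).2.2 := by rw [t2, u2, hb1']
    have ha0 : (t 0).1 = (u 0).1 := by
      have et : (t 0).1 = (t 0).1 + (t 0).2.2 - (t 0).2.2 := (add_sub_cancel_right _ _).symm
      have eu : (u 0).1 = (u 0).1 + (u 0).2.2 - (u 0).2.2 := (add_sub_cancel_right _ _).symm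
      rw [et, eu, hs', hb0']
    have hb0 : (t 0).2.1 = (u 0).2.1 := by
      have et : (t 0).2.1 = (t 0).1 + (t 0).2.1 - (t 0).1 := (add_sub_cancel_left _ _).symm
      have eu : (u 0).2.1 = (u 0).1 + (u 0).2.1 - (u 0).1 := (add_sub_cancel_left _ _).symm
      rw [et, eu, hs, ha0]
    funext j
    fin_cases j
    · exact Prod.ext ha0 (Prod.ext hb0 hb0')
    · exact Prod.ext ha1 (Prod.ext hb1 hb1')

/-- **Theorem 1.1, display (6), for `G` on which subtraction is injective: `#G ≤ N^{7/4}`**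
(display (17)), in integers `(#G)⁴ ≤ N⁷`: from (13) `(#G)² ≤ N #V`, (18) `(#V)² ≤ N² #T` and
`#T ≤ N³`, so `#V ≤ N^{5/2}`. [cite: KatzTao1999ArithmeticProjections, Thm 1.1 (6) / §4
display (17) (pp. 625, 629–630)] -/
theorem card_pow_four_le_of_injOn {A B : Finset Z} {G : Finset (Z × Z)} (hG : G ⊆ A ×ˢ B)
    (hinj : Set.InjOn (fun p : Z × Z => p.1 - p.2) ↑G) {N : ℕ} (hA : A.card ≤ N)
    (hB : B.card ≤ N) (hC : (sums G).card ≤ N) (hD : (sumsTwo G).card ≤ N) :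
    G.card ^ 4 ≤ N ^ 7 := by
  set V := (vert G).card with hVdef
  have h13 : G.card ^ 2 ≤ V * N :=
    (card_sq_le_card_vert_mul hG).trans (Nat.mul_le_mul_left _ hA)
  have h18 : V ^ 2 ≤ N ^ 5 := by
    calc V ^ 2 ≤ (tee G).card * ((sumsTwo G).card * B.card) := card_vert_sq_le hG
      _ ≤ ((sums G).card * ((sums G).card * B.card)) * ((sumsTwo G).card * B.card) :=
          Nat.mul_le_mul_right _ (card_tee_le hG hinj)
      _ ≤ (N * (N * N)) * (N * N) := by gcongr
      _ = N ^ 5 := by ring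
  calc G.card ^ 4 = (G.card ^ 2) ^ 2 := by ring
    _ ≤ (V * N) ^ 2 := Nat.pow_le_pow_left h13 2
    _ = V ^ 2 * N ^ 2 := by ring
    _ ≤ N ^ 5 * N ^ 2 := Nat.mul_le_mul_right _ h18
    _ = N ^ 7 := by ring

/-- **Theorem 1.1 (Katz–Tao 1999), display (6), in integers.**  Let `Z` be an abelian group,
`A, B ⊆ Z` finite with `#A, #B ≤ N`, and `G ⊆ A × B` with `#{a + b : (a, b) ∈ G} ≤ N` and
`#{a + 2b : (a, b) ∈ G} ≤ N`; then `#{a − b : (a, b) ∈ G}⁴ ≤ N⁷`.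
[cite: KatzTao1999ArithmeticProjections, Thm 1.1 (6) (p. 625)] -/
theorem card_diffs_pow_four_le {A B : Finset Z} {G : Finset (Z × Z)} (hG : G ⊆ A ×ˢ B) {N : ℕ}
    (hA : A.card ≤ N) (hB : B.card ≤ N) (hC : (sums G).card ≤ N)
    (hD : (sumsTwo G).card ≤ N) : (diffs G).card ^ 4 ≤ N ^ 7 := by
  obtain ⟨G', hG'G, hinj, hcard⟩ := exists_subset_injOn_card_eq G
  rw [← hcard]
  exact card_pow_four_le_of_injOn (hG'G.trans hG) hinj hA hB
    ((Finset.card_le_card (sums_mono hG'G)).trans hC)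
    ((Finset.card_le_card (sumsTwo_mono hG'G)).trans hD)

/-- **Theorem 1.1 (Katz–Tao 1999), display (6), exactly as printed: under (1), (3) and the
further assumption (5) `#{a + 2b : (a, b) ∈ G} ≤ N`, `#{a − b : (a, b) ∈ G} ≤ N^{2 − 1/4}`.**
[cite: KatzTao1999ArithmeticProjections, Thm 1.1 (6) (p. 625)] -/
theorem card_diffs_le_rpow_of_sumsTwo {A B : Finset Z} {G : Finset (Z × Z)} (hG : G ⊆ A ×ˢ B)
    {N : ℕ} (hA : A.card ≤ N) (hB : B.card ≤ N) (hC : (sums G).card ≤ N)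
    (hD : (sumsTwo G).card ≤ N) :
    ((diffs G).card : ℝ) ≤ (N : ℝ) ^ (2 - 1 / 4 : ℝ) := by
  have h := le_rpow_of_pow_le_pow (by norm_num) (card_diffs_pow_four_le hG hA hB hC hD)
  norm_num at h ⊢
  exact h

end SumsAndDifferences

section Examples

/-! ### The examples of §1: `(2)` can be as large as `N^{log 6/log 3}` under (3), and `N^{3/2}`
under (3) and (5) -/

variable {Z : Type*} [DecidableEq Z]

/-- The `n`-fold Cartesian power `G₁ⁿ ⊆ Zⁿ × Zⁿ` of a set of pairs `G₁ ⊆ Z × Z` ("`G = {…}ⁿ`",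
§1 p. 626). [cite: KatzTao1999ArithmeticProjections, §1 (p. 626)] -/
def powGraph (n : ℕ) (G₁ : Finset (Z × Z)) : Finset ((Fin n → Z) × (Fin n → Z)) :=
  (Fintype.piFinset fun _ : Fin n => G₁).image fun c => (fun i => (c i).1, fun i => (c i).2)

/-- Membership in `G₁ⁿ`: coordinatewise membership in `G₁`. [cite: KatzTao1999ArithmeticProjections,
§1 (p. 626)] -/
theorem mem_powGraph_iff {n : ℕ} {G₁ : Finset (Z × Z)} {p : (Fin n → Z) × (Fin n → Z)} :
    p ∈ powGraph n G₁ ↔ ∀ i, (p.1 i, p.2 i) ∈ G₁ := by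
  constructor
  · intro hp
    obtain ⟨c, hc, rfl⟩ := Finset.mem_image.1 hp
    exact fun i => by simpa using Fintype.mem_piFinset.1 hc i
  · intro hp
    refine Finset.mem_image.2 ⟨fun i => (p.1 i, p.2 i), Fintype.mem_piFinset.2 hp, ?_⟩
    simp

/-- `#G₁ⁿ = (#G₁)ⁿ`. [cite: KatzTao1999ArithmeticProjections, §1 (p. 626)] -/
theorem card_powGraph (n : ℕ) (G₁ : Finset (Z × Z)) : (powGraph n G₁).card = G₁.card ^ n := by
  rw [powGraph, Finset.card_image_of_injective, Fintype.card_piFinset_const]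
  intro c c' h
  simp only [Prod.mk.injEq] at h
  funext i
  exact Prod.ext (congrFun h.1 i) (congrFun h.2 i)

/-- `G₁ ⊆ A₁ × B₁` gives `G₁ⁿ ⊆ A₁ⁿ × B₁ⁿ`. [cite: KatzTao1999ArithmeticProjections, §1 (p. 626)] -/
theorem powGraph_subset {n : ℕ} {A₁ B₁ : Finset Z} {G₁ : Finset (Z × Z)} (h : G₁ ⊆ A₁ ×ˢ B₁) :
    powGraph n G₁ ⊆ (Fintype.piFinset fun _ : Fin n => A₁) ×ˢ (Fintype.piFinset fun _ : Fin n => B₁) := by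
  intro p hp
  have hp' := mem_powGraph_iff.1 hp
  exact Finset.mem_product.2 ⟨Fintype.mem_piFinset.2 fun i => (Finset.mem_product.1 (h (hp' i))).1,
    Fintype.mem_piFinset.2 fun i => (Finset.mem_product.1 (h (hp' i))).2⟩

variable [AddCommGroup Z]

/-- The sums of `G₁ⁿ` lie in `C₁ⁿ`, `C₁` the sums of `G₁`. [cite: KatzTao1999ArithmeticProjections,
§1 (p. 626)] -/
theorem sums_powGraph_subset (n : ℕ) (G₁ : Finset (Z × Z)) :
    sums (powGraph n G₁) ⊆ Fintype.piFinset fun _ : Fin n => sums G₁ := by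
  intro x hx
  obtain ⟨p, hp, rfl⟩ := Finset.mem_image.1 hx
  have hp' := mem_powGraph_iff.1 hp
  exact Fintype.mem_piFinset.2 fun i => Finset.mem_image.2 ⟨(p.1 i, p.2 i), hp' i, rfl⟩

/-- The sums `a + 2b` of `G₁ⁿ` lie in `D₁ⁿ`, `D₁` those of `G₁`.
[cite: KatzTao1999ArithmeticProjections, §1 (p. 626)] -/
theorem sumsTwo_powGraph_subset (n : ℕ) (G₁ : Finset (Z × Z)) :
    sumsTwo (powGraph n G₁) ⊆ Fintype.piFinset fun _ : Fin n => sumsTwo G₁ := by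
  intro x hx
  obtain ⟨p, hp, rfl⟩ := Finset.mem_image.1 hx
  have hp' := mem_powGraph_iff.1 hp
  exact Fintype.mem_piFinset.2 fun i => Finset.mem_image.2 ⟨(p.1 i, p.2 i), hp' i, rfl⟩

/-- If subtraction is injective on `G₁` it is injective on `G₁ⁿ`, so `#{a − b : (a, b) ∈ G₁ⁿ} =
(#G₁)ⁿ`. [cite: KatzTao1999ArithmeticProjections, §1 (p. 626: "(2) = #G = 6ⁿ")] -/
theorem card_diffs_powGraph {n : ℕ} {G₁ : Finset (Z × Z)}
    (hinj : Set.InjOn (fun p : Z × Z => p.1 - p.2) ↑G₁) :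
    (diffs (powGraph n G₁)).card = G₁.card ^ n := by
  rw [← card_powGraph n G₁, diffs]
  refine Finset.card_image_of_injOn fun p hp q hq hpq => ?_
  have hp' := mem_powGraph_iff.1 (Finset.mem_coe.1 hp)
  have hq' := mem_powGraph_iff.1 (Finset.mem_coe.1 hq)
  have h : ∀ i, (p.1 i, p.2 i) = (q.1 i, q.2 i) := fun i =>
    hinj (hp' i) (hq' i) (by simpa using congrFun hpq i)
  exact Prod.ext (funext fun i => congrArg Prod.fst (h i)) (funext fun i => congrArg Prod.snd (h i))

/-- The base of the first example: `A = B = {0, 1, 3}`, `C = {1, 3, 4}`,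
`G = {(0,1), (0,3), (1,0), (1,3), (3,0), (3,1)}` in `ℤ`. [cite: KatzTao1999ArithmeticProjections,
§1 (p. 626)] -/
def baseG₁ : Finset (ℤ × ℤ) := {(0, 1), (0, 3), (1, 0), (1, 3), (3, 0), (3, 1)}

/-- The base of the second example: `A = {0,2,3,4}`, `B = {0,1,2,3}`, `C = {2,3,4,5}`,
`D = {4,5,6,8}`, `G = {(4,0), (2,1), (3,1), (4,1), (0,2), (2,2), (0,3), (2,3)}` in `ℤ`.
[cite: KatzTao1999ArithmeticProjections, §1 (p. 626)] -/
def baseG₂ : Finset (ℤ × ℤ) := {(4, 0), (2, 1), (3, 1), (4, 1), (0, 2), (2, 2), (0, 3), (2, 3)}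

/-- **The first example of §1: under (1) and (3), the quantity (2) can be as large as
`N^{log 6/log 3} = N^{2 − 0.36907…}`.**  "Let `n` be a large integer and set `Z = ℤⁿ`,
`A = B = {0, 1, 3}ⁿ`, `C = {1, 3, 4}ⁿ` and `G = {(0,1), (0,3), (1,0), (1,3), (3,0), (3,1)}ⁿ`; we see
that the hypotheses are satisfied with `N = 3ⁿ` and (2) `= #G = 6ⁿ`."
[cite: KatzTao1999ArithmeticProjections, §1 (p. 626)] -/
theorem exists_card_diffs_eq_six_pow (n : ℕ) :
    ∃ (A B : Finset (Fin n → ℤ)) (G : Finset ((Fin n → ℤ) × (Fin n → ℤ))),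
      G ⊆ A ×ˢ B ∧ A.card = 3 ^ n ∧ B.card = 3 ^ n ∧ (sums G).card ≤ 3 ^ n ∧
        G.card = 6 ^ n ∧ (diffs G).card = 6 ^ n := by
  have hsub : baseG₁ ⊆ ({0, 1, 3} : Finset ℤ) ×ˢ ({0, 1, 3} : Finset ℤ) := by decide
  have hsums : sums baseG₁ ⊆ ({1, 3, 4} : Finset ℤ) := by decide
  have hinj : Set.InjOn (fun p : ℤ × ℤ => p.1 - p.2) ↑baseG₁ :=
    Finset.card_image_iff.1 (by decide)
  refine ⟨Fintype.piFinset fun _ => {0, 1, 3}, Fintype.piFinset fun _ => {0, 1, 3},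
    powGraph n baseG₁, powGraph_subset hsub, ?_, ?_, ?_, ?_, card_diffs_powGraph hinj⟩
  · rw [Fintype.card_piFinset_const]; rfl
  · rw [Fintype.card_piFinset_const]; rfl
  · calc (sums (powGraph n baseG₁)).card ≤ (Fintype.piFinset fun _ : Fin n => sums baseG₁).card :=
          Finset.card_le_card (sums_powGraph_subset n _)
      _ = (sums baseG₁).card ^ n := Fintype.card_piFinset_const _ _
      _ ≤ 3 ^ n := Nat.pow_le_pow_left (Finset.card_le_card hsums) n
  · exact card_powGraph n _

/-- `6ⁿ = (3ⁿ)^{log 6/log 3}`: the first example has `(2) = N^{log 6/log 3}`, `N = 3ⁿ`.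
[cite: KatzTao1999ArithmeticProjections, §1 (p. 626)] -/
theorem six_pow_eq_rpow (n : ℕ) : ((6 : ℝ) ^ n) = ((3 : ℝ) ^ n) ^ (Real.log 6 / Real.log 3) := by
  have h3 : Real.log 3 ≠ 0 := (Real.log_pos (by norm_num)).ne'
  rw [← Real.rpow_natCast (3 : ℝ) n, ← Real.rpow_mul (by norm_num),
    Real.rpow_def_of_pos (by norm_num : (0 : ℝ) < 3), ← Real.rpow_natCast (6 : ℝ) n,
    Real.rpow_def_of_pos (by norm_num : (0 : ℝ) < 6)]
  congr 1
  field_simp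

/-- **The second example of §1: under (1), (3) and (5), the quantity (2) can be as large as
`N^{log 8/log 4} = N^{3/2}`.**  "The latter claim is similar but uses the sets `Z = ℤⁿ`,
`A = {0,2,3,4}ⁿ`, `C = {2,3,4,5}ⁿ`, `B = {0,1,2,3}ⁿ`, `D = {4,5,6,8}ⁿ` and
`G = {(4,0), (2,1), (3,1), (4,1), (0,2), (2,2), (0,3), (2,3)}ⁿ`" (`N = 4ⁿ`, (2) `= #G = 8ⁿ`).
[cite: KatzTao1999ArithmeticProjections, §1 (p. 626)] -/
theorem exists_card_diffs_eq_eight_pow (n : ℕ) :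
    ∃ (A B : Finset (Fin n → ℤ)) (G : Finset ((Fin n → ℤ) × (Fin n → ℤ))),
      G ⊆ A ×ˢ B ∧ A.card = 4 ^ n ∧ B.card = 4 ^ n ∧ (sums G).card ≤ 4 ^ n ∧
        (sumsTwo G).card ≤ 4 ^ n ∧ G.card = 8 ^ n ∧ (diffs G).card = 8 ^ n := by
  have hsub : baseG₂ ⊆ ({0, 2, 3, 4} : Finset ℤ) ×ˢ ({0, 1, 2, 3} : Finset ℤ) := by decide
  have hsums : sums baseG₂ ⊆ ({2, 3, 4, 5} : Finset ℤ) := by decide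
  have hsums2 : sumsTwo baseG₂ ⊆ ({4, 5, 6, 8} : Finset ℤ) := by decide
  have hinj : Set.InjOn (fun p : ℤ × ℤ => p.1 - p.2) ↑baseG₂ :=
    Finset.card_image_iff.1 (by decide)
  refine ⟨Fintype.piFinset fun _ => {0, 2, 3, 4}, Fintype.piFinset fun _ => {0, 1, 2, 3},
    powGraph n baseG₂, powGraph_subset hsub, ?_, ?_, ?_, ?_, ?_, card_diffs_powGraph hinj⟩
  · rw [Fintype.card_piFinset_const]; rfl
  · rw [Fintype.card_piFinset_const]; rfl
  · calc (sums (powGraph n baseG₂)).card ≤ (Fintype.piFinset fun _ : Fin n => sums baseG₂).card :=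
          Finset.card_le_card (sums_powGraph_subset n _)
      _ = (sums baseG₂).card ^ n := Fintype.card_piFinset_const _ _
      _ ≤ 4 ^ n := Nat.pow_le_pow_left (Finset.card_le_card hsums) n
  · calc (sumsTwo (powGraph n baseG₂)).card
        ≤ (Fintype.piFinset fun _ : Fin n => sumsTwo baseG₂).card :=
          Finset.card_le_card (sumsTwo_powGraph_subset n _)
      _ = (sumsTwo baseG₂).card ^ n := Fintype.card_piFinset_const _ _
      _ ≤ 4 ^ n := Nat.pow_le_pow_left (Finset.card_le_card hsums2) n
  · exact card_powGraph n _

end Examples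

section LargeN

/-! ### "(2) can be as large as `N^{log 6/log 3}`" — for arbitrarily large `N` -/

/-- **The first example for arbitrarily large `N`, in the printed form** (p. 626: "(2) can be as
large as `N^{log(6)/log(3)} = N^{2−0.36907…}` if one assumes (3)"): for every `N₀` there are
`N ≥ N₀` and `A, B, G` satisfying (1) and (3) with `#{a − b : (a, b) ∈ G} = N^{log 6/log 3}`
(namely `N = 3ⁿ`, the sets of `exists_card_diffs_eq_six_pow`).  Mattila (Prop. 23.8 ff.):
"one cannot take `ε₀` larger than `2 − log 6/log 3`". [cite: KatzTao1999ArithmeticProjections,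
§1 (p. 626)] [cite: Mattila2015, §23.3 (p. 345)] -/
theorem exists_card_diffs_eq_rpow_log (N₀ : ℕ) :
    ∃ N ≥ N₀, ∃ (n : ℕ) (A B : Finset (Fin n → ℤ)) (G : Finset ((Fin n → ℤ) × (Fin n → ℤ))),
      G ⊆ A ×ˢ B ∧ A.card = N ∧ B.card = N ∧ (sums G).card ≤ N ∧
        ((diffs G).card : ℝ) = (N : ℝ) ^ (Real.log 6 / Real.log 3) := by
  obtain ⟨A, B, G, hG, hA, hB, hC, -, hD⟩ := exists_card_diffs_eq_six_pow N₀
  refine ⟨3 ^ N₀, (Nat.lt_pow_self (by norm_num : 1 < 3)).le, N₀, A, B, G, hG, hA, hB, hC, ?_⟩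
  rw [hD]
  push_cast
  exact six_pow_eq_rpow N₀

/-- `8ⁿ = (4ⁿ)^{3/2}`: the second example has `(2) = N^{3/2} = N^{2 − 1/2}`, `N = 4ⁿ`.
[cite: KatzTao1999ArithmeticProjections, §1 (p. 626)] -/
theorem eight_pow_eq_rpow (n : ℕ) : ((8 : ℝ) ^ n) = ((4 : ℝ) ^ n) ^ (3 / 2 : ℝ) := by
  rw [show (4 : ℝ) ^ n = (2 : ℝ) ^ (2 * n) by rw [pow_mul]; norm_num,
    show (8 : ℝ) ^ n = (2 : ℝ) ^ (3 * n) by rw [pow_mul]; norm_num,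
    ← Real.rpow_natCast (2 : ℝ) (2 * n), ← Real.rpow_mul (by norm_num : (0 : ℝ) ≤ 2),
    ← Real.rpow_natCast (2 : ℝ) (3 * n)]
  congr 1
  push_cast
  ring

/-- **The second example for arbitrarily large `N`, in the printed form** (p. 626: "or as large as
`N^{log(8)/log(4)} = N^{2 − 1/2}` if one also assumes (5)"): for every `N₀` there are `N ≥ N₀` and
`A, B, G` satisfying (1), (3) and (5) with `#{a − b : (a, b) ∈ G} = N^{3/2}` (`N = 4ⁿ`, the sets
of `exists_card_diffs_eq_eight_pow`). [cite: KatzTao1999ArithmeticProjections, §1 (p. 626)] -/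
theorem exists_card_diffs_eq_rpow_three_halves (N₀ : ℕ) :
    ∃ N ≥ N₀, ∃ (n : ℕ) (A B : Finset (Fin n → ℤ)) (G : Finset ((Fin n → ℤ) × (Fin n → ℤ))),
      G ⊆ A ×ˢ B ∧ A.card = N ∧ B.card = N ∧ (sums G).card ≤ N ∧ (sumsTwo G).card ≤ N ∧
        ((diffs G).card : ℝ) = (N : ℝ) ^ (3 / 2 : ℝ) := by
  obtain ⟨A, B, G, hG, hA, hB, hC, hD2, -, hD⟩ := exists_card_diffs_eq_eight_pow N₀
  refine ⟨4 ^ N₀, (Nat.lt_pow_self (by norm_num : 1 < 4)).le, N₀, A, B, G, hG, hA, hB, hC, hD2,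
    ?_⟩
  rw [hD]
  push_cast
  exact eight_pow_eq_rpow N₀

/-- **Consequently the exponent `2 − 1/6` of (4) cannot be lowered below `log 6/log 3 = 1.6309…`**:
for every real `e < log 6/log 3` and every `N₀` there are `N ≥ N₀` and `A, B, G` satisfying
(1) and (3) with `#{a − b : (a, b) ∈ G} > N^e`. [cite: KatzTao1999ArithmeticProjections, §1
(p. 626)] [cite: Mattila2015, §23.3 (p. 345)] -/
theorem exists_rpow_lt_card_diffs {e : ℝ} (he : e < Real.log 6 / Real.log 3) (N₀ : ℕ) :
    ∃ N ≥ N₀, ∃ (n : ℕ) (A B : Finset (Fin n → ℤ)) (G : Finset ((Fin n → ℤ) × (Fin n → ℤ))),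
      G ⊆ A ×ˢ B ∧ A.card = N ∧ B.card = N ∧ (sums G).card ≤ N ∧
        (N : ℝ) ^ e < (diffs G).card := by
  obtain ⟨N, hN, n, A, B, G, hG, hA, hB, hC, hD⟩ := exists_card_diffs_eq_rpow_log (max N₀ 2)
  refine ⟨N, le_of_max_le_left hN, n, A, B, G, hG, hA, hB, hC, ?_⟩
  rw [hD]
  have hN1 : (1 : ℝ) < N := by exact_mod_cast lt_of_lt_of_le (by norm_num) (le_of_max_le_right hN)
  exact Real.rpow_lt_rpow_of_exponent_lt hN1 he

end LargeN

end SumsDifferences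

end Literature.Combinatorics.Kakeya
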